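import Summits.AnomalousDissipation.AnomalousDissipation.Theorems.ImpulseGridGridThesisStubAcdcDesignIntegrals

/-!
# Line `Sketch` for crux `GridSignsLaw` (item stmt-AnomalousDissipation-14349, route ImpulseGrid):
stub `stub_acdcPatternNormSq`, the squared `L²` norm of the AC/DC pattern

Companion analysis stub of the line `Sketch` of the crux
`Summit.AnomalousDissipation.AnomalousDissipation.Theses.ImpulseGrid.GridSignsLaw`. For the
explicit cellular two-mode Stokes pattern of the AC/DC grid design (Stokes modes of frequencies
`(0, m, ±m)`), `G = A[sin 2πm(x₁+x₂)·(e₁−e₂) + sin 2πm(x₁−x₂)·(e₁+e₂)]` with `m ≥ 1`, we prove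
`∫‖G‖² = 2A²`.

Proof. Pointwise, with `p = Im e_{(0,m,m)}(x)` and `q = Im e_{(0,m,−m)}(x)`,
`G x = A[(p+q) e₁ + (q−p) e₂]`, so `‖G x‖² = A²[(p+q)² + (q−p)²] = A²(2p² + 2q²)` (the two
amplitude vectors `e₁ ∓ e₂` are orthogonal of squared length `2`). For a character `e_k` of
`T^d` one has `|e_k| = 1`, hence `(Im e_k)² = (1 − Re e_k²)/2` with `e_k² = e_{2k}`
(`UnitAddTorus.mFourier_add`); if `kᵢ ≠ 0` the character `e_{2k}` changes sign under the axis
translation `x ↦ x + eᵢ/(4kᵢ)` (`AcdcDesign.mFourier_add_single_half`), so `∫ Re e_{2k} = 0` by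
translation invariance of the Haar measure (`AcdcDesign.integral_eq_zero_of_forall_add_eq_neg`)
and `∫ (Im e_k)² = ½` (the torus has total mass `1`). Hence `∫‖G‖² = A²(2·½ + 2·½) = 2A²`.

References: Grafakos 2014, §3.1.1 (characters of `T^d`); Constantin–Foias 1988, Ch. 4 (4.13)
(Stokes eigenfields on the torus). No new definitions.
-/

noncomputable section

-- `Summit.<Summit>.<Problem>` is the tree's mandated summit-side namespace (CONVENTIONS §2); for
-- this single-conjunct summit the two coincide, so the duplicate is deliberate.
set_option linter.dupNamespace false

open MeasureTheory Set Filter Topology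
open scoped InnerProductSpace RealInnerProductSpace

namespace Summit.AnomalousDissipation.AnomalousDissipation.Theorems

open Literature.Analysis.FunctionSpaces Literature.Analysis.FunctionSpaces.Torus
open Literature.Analysis.FluidPDE Literature.Analysis.FluidPDE.Torus

local notation "𝕋³" => UnitAddTorus (Fin 3)
local notation "E³" => EuclideanSpace ℝ (Fin 3)

namespace AcdcPatternNorm

/-- `|e_k(x)| = 1` in the form `(Re e_k)² + (Im e_k)² = 1`. [folklore] -/
theorem re_sq_add_im_sq_mFourier {d : Type*} [Fintype d] (k : d → ℤ) (x : UnitAddTorus d) :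
    (UnitAddTorus.mFourier k x).re ^ 2 + (UnitAddTorus.mFourier k x).im ^ 2 = 1 := by
  have h : ‖UnitAddTorus.mFourier k x‖ = 1 := by
    simp [UnitAddTorus.mFourier, fourier_apply]
  have h2 : Complex.normSq (UnitAddTorus.mFourier k x) = 1 := by
    rw [← Complex.sq_norm, h, one_pow]
  rw [Complex.normSq_apply] at h2
  simpa only [sq] using h2

/-- The double-angle formula `(Im e_k)² = (1 − Re (e_k·e_k))/2` (from `|e_k| = 1`).
[folklore] -/
theorem im_mFourier_sq {d : Type*} [Fintype d] (k : d → ℤ) (x : UnitAddTorus d) :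
    (UnitAddTorus.mFourier k x).im ^ 2 =
      (1 - (UnitAddTorus.mFourier k x * UnitAddTorus.mFourier k x).re) / 2 := by
  rw [Complex.mul_re]
  linear_combination (1 / 2 : ℝ) * re_sq_add_im_sq_mFourier k x

/-- `∫ Re (e_k·e_k) = 0` as soon as some `kᵢ ≠ 0`: `e_k² = e_{2k}` changes sign under the axis
translation `x ↦ x + eᵢ/(4kᵢ)` (`AcdcDesign.mFourier_add_single_half`), and a function that
changes sign under a translation has integral zero
(`AcdcDesign.integral_eq_zero_of_forall_add_eq_neg`). [folklore] -/
theorem integral_re_mFourier_mul_self {d : Type*} [Fintype d] [DecidableEq d] {k : d → ℤ}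
    {i : d} (hk : k i ≠ 0) :
    ∫ x, (UnitAddTorus.mFourier k x * UnitAddTorus.mFourier k x).re = 0 := by
  have hk2 : (k + k) i ≠ 0 := by
    rw [Pi.add_apply]
    omega
  exact AcdcDesign.integral_eq_zero_of_forall_add_eq_neg _ _ fun x => by
    rw [← UnitAddTorus.mFourier_add, ← UnitAddTorus.mFourier_add,
      AcdcDesign.mFourier_add_single_half hk2, Complex.neg_re]

/-- `∫ (Im e_k)² = ½` as soon as some `kᵢ ≠ 0` (double-angle formula, `∫ Re e_{2k} = 0`, and
the torus has total mass `1`). [folklore] -/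
theorem integral_im_mFourier_sq {d : Type*} [Fintype d] [DecidableEq d] {k : d → ℤ} {i : d}
    (hk : k i ≠ 0) : ∫ x, (UnitAddTorus.mFourier k x).im ^ 2 = 1 / 2 := by
  simp_rw [im_mFourier_sq]
  have hc : Continuous fun x : UnitAddTorus d =>
      (UnitAddTorus.mFourier k x * UnitAddTorus.mFourier k x).re :=
    Complex.continuous_re.comp
      ((UnitAddTorus.mFourier k).continuous.mul (UnitAddTorus.mFourier k).continuous)
  rw [integral_div, integral_sub (integrable_const _) hc.integrable_unitAddTorus,
    integral_re_mFourier_mul_self hk, integral_const]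
  simp

/-- The pointwise squared norm of the cellular amplitude: for real `p, q`,
`‖p(e₁ − e₂) + q(e₁ + e₂)‖² = 2p² + 2q²` in `ℝ³` (`= (p+q)² + (q−p)²`; the two amplitude
vectors are orthogonal with squared length `2`). [folklore] -/
theorem norm_sq_amplitude (p q : ℝ) :
    ‖p • (EuclideanSpace.single (1 : Fin 3) (1 : ℝ) - EuclideanSpace.single (2 : Fin 3) (1 : ℝ)) +
        q • (EuclideanSpace.single (1 : Fin 3) (1 : ℝ) +
          EuclideanSpace.single (2 : Fin 3) (1 : ℝ))‖ ^ 2 =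
      2 * p ^ 2 + 2 * q ^ 2 := by
  rw [EuclideanSpace.real_norm_sq_eq, Fin.sum_univ_three]
  simp only [PiLp.add_apply, PiLp.smul_apply, PiLp.sub_apply, PiLp.single_apply, Fin.isValue,
    Fin.reduceEq, if_true, if_false, smul_eq_mul]
  ring

end AcdcPatternNorm

/-- **Stub of crux `GridSignsLaw` (item stmt-AnomalousDissipation-14349), line `Sketch`: the
squared `L²` norm of the AC/DC pattern.** For
`G = A[sin 2πm(x₁+x₂)(e₁−e₂) + sin 2πm(x₁−x₂)(e₁+e₂)]`, `m ≥ 1`: `∫‖G‖² = 2A²` (pointwise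
`‖G x‖² = A²(2 sin²2πm(x₁+x₂) + 2 sin²2πm(x₁−x₂))`, `AcdcPatternNorm.norm_sq_amplitude`,
and `∫ sin²(2πk·x) = ½` for `k₁ = m ≠ 0`, `AcdcPatternNorm.integral_im_mFourier_sq`).
[folklore] -/
theorem stub_acdcPatternNormSq :
    ∀ (m : ℕ) (A : ℝ) (G : 𝕋³ → E³),
      G = (fun x => A • (stokesMode ![(0 : ℤ), (m : ℤ), (m : ℤ)]
            (EuclideanSpace.single (1 : Fin 3) (1 : ℝ) - EuclideanSpace.single (2 : Fin 3) (1 : ℝ)) false x +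
          stokesMode ![(0 : ℤ), (m : ℤ), -(m : ℤ)]
            (EuclideanSpace.single (1 : Fin 3) (1 : ℝ) + EuclideanSpace.single (2 : Fin 3) (1 : ℝ)) false x)) →
      1 ≤ m → ∫ x, ‖G x‖ ^ 2 = 2 * A ^ 2 := by
  intro m A G hGd hm
  -- both frequencies have first component `m ≠ 0`
  have hm0 : m ≠ 0 := by omega
  have h1 : (![(0 : ℤ), (m : ℤ), (m : ℤ)] : Fin 3 → ℤ) 1 ≠ 0 := by simpa using hm0
  have h2 : (![(0 : ℤ), (m : ℤ), -(m : ℤ)] : Fin 3 → ℤ) 1 ≠ 0 := by simpa using hm0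
  -- pointwise squared norm
  have hpt : ∀ x, ‖G x‖ ^ 2 =
      2 * A ^ 2 * (UnitAddTorus.mFourier ![(0 : ℤ), (m : ℤ), (m : ℤ)] x).im ^ 2 +
        2 * A ^ 2 * (UnitAddTorus.mFourier ![(0 : ℤ), (m : ℤ), -(m : ℤ)] x).im ^ 2 := by
    intro x
    rw [hGd]
    dsimp only
    rw [AcdcDesign.stokesMode_false_apply, AcdcDesign.stokesMode_false_apply, norm_smul, mul_pow,
      Real.norm_eq_abs, sq_abs, AcdcPatternNorm.norm_sq_amplitude]
    ring
  -- integrate: continuous integrands on the compact torus, `∫ (Im e_k)² = ½`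
  have hc : ∀ k : Fin 3 → ℤ,
      Continuous fun x : 𝕋³ => 2 * A ^ 2 * (UnitAddTorus.mFourier k x).im ^ 2 := fun k =>
    continuous_const.mul ((Complex.continuous_im.comp (UnitAddTorus.mFourier k).continuous).pow 2)
  simp_rw [hpt]
  rw [integral_add (hc _).integrable_unitAddTorus (hc _).integrable_unitAddTorus,
    integral_const_mul, integral_const_mul, AcdcPatternNorm.integral_im_mFourier_sq h1,
    AcdcPatternNorm.integral_im_mFourier_sq h2]
  ring

end Summit.AnomalousDissipation.AnomalousDissipation.Theorems

end
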